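import Summits.CriticalPhenomena.PercolationContinuityZ3.Theorems.PercNearOneGluingNoHeavyLowerTailFrontierDecRowsPinnedEdgeKeyAll
import HarnessLib

/-!
# The relaxed KEY form `K + B₀ = 3B₁ − B₀`: ONE cubic whose nonnegativity (with the induction hypotheses) gives BOTH mixed Bernstein coefficients

Support file (prover seat `prim-facecert`, gen 6; `--supports stmt-CriticalPhenomena-4575`).  No named facts, no sorries, no `native_decide`;
one bookkeeping definition `KeyB0HypAtAll` (the `K + B₀` analogue of prim-l12-p6's `KeyHypAtAll`).

WHY.  Along a (terminal, unmarked) edge `e` the row cubic is `T(p) = (1−p)³B₀ + 3p(1−p)²B₁ + 3p²(1−p)B₂ + p³B₃` with `B₀ = E₃(μ⁰)`, `B₃ = E₃(μ¹)`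
(induction hypotheses) and (bnk-1 gen 9, `polar₁_eq_key`, `three_mul_polar₁_swap`)
    `3B₁ = 2B₀ + K`,   `3B₂ = B₀ + B₃ + K + π_A π_B π_C`,   `K = key μ⁰ μ¹`.
The certificate programme (prim-facecert gens 4–5, prim-bnk-1 gens 9–12) targeted `K ≥ 0`.  But the induction (`UnmarkedEdgeHypAtAll`, p6 gen 4) only needs
`B₁ ≥ 0` and `B₂ ≥ 0`, and BOTH follow from the single weaker inequality
    `keyB0 := K + B₀ = 3B₁ − B₀ ≥ 0`:      `3B₁ = keyB0 + B₀`,   `3B₂ = keyB0 + B₃ + π_A π_B π_C`.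
Numerically (PATH at the hub, ttrl cp-key KEY.md §3 and this seat's exact sampling): `min K/(B₀+B₃) = 1.09e-5` over `n ≤ 7` and `→ 0` along `B₃ = 0` families
(`B₁/B₀ → 2/3`), i.e. `K ≥ 0` is TIGHT, which is what defeats low-degree polynomial certificates; whereas `keyB0/(B₀+B₃) ≥ 0.19` (p6 gen 4 table: `B₁/(B₀+B₃) ≥ 0.063`)
— the tight family of `K` has `keyB0 ≈ B₀ > 0`.  A polynomial certificate `keyB0·σ = λ₀·B₀ + λ₁·B₃ + Σ(rows)` is therefore the natural LP target, and this file is its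
certificate-independent consumer:
* `keyB0`, `keyB0_eq`, `polar₁_nonneg_of_keyB0`, `polar₁_swap_nonneg_of_keyB0`;
* `KeyB0HypAtAll i₀ E₁ E₂ E₃` (as `KeyHypAtAll` with conclusion `0 ≤ keyB0`), `KeyHypAtAll.toKeyB0`, `unmarkedEdgeHypAtAll_of_keyB0HypAtAll`;
* `sahiE3_sep_nonneg_of_keyB0HypAtAll` (any row of group separations pinned at one terminal), `frontier_36_all_of_keyB0AtAll (i₀ : Fin 4)` (PATH, all markings).
-/

noncomputable section

namespace Summit.CriticalPhenomena.PercolationContinuityZ3.Theorems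

namespace TerminalEdgeInduction

open MeasureTheory Literature.Probability.Percolation Literature.Probability.LatticeModels
open EdgeInduction CovTransferCert E3GroupSepCert
open scoped Classical

variable {n k : ℕ}

/-- **The relaxed KEY form** `keyB0 = K + B₀ = 3·F(μ,μ,ν) − E₃(μ)` of an edge step (`μ` = law with the edge closed, `ν` = law with the edge open). [this work] -/
def keyB0 (μ ν : Measure (BondConfig (Fin n))) (A B C : Set (BondConfig (Fin n))) : ℝ :=
  key μ ν A B C + sahiE3 μ A B C

/-- `keyB0 = 3B₁ − B₀`. [this work] -/
theorem keyB0_eq (μ ν : Measure (BondConfig (Fin n))) (A B C : Set (BondConfig (Fin n))) :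
    keyB0 μ ν A B C = 3 * polar₁ μ ν A B C - sahiE3 μ A B C := by
  simp only [keyB0, key]
  ring

/-- `3B₁ = keyB0 + B₀`. [this work] -/
theorem three_mul_polar₁_eq_keyB0 (μ ν : Measure (BondConfig (Fin n))) (A B C : Set (BondConfig (Fin n))) :
    3 * polar₁ μ ν A B C = keyB0 μ ν A B C + sahiE3 μ A B C := by
  simp only [keyB0, key]
  ring

/-- `3B₂ = keyB0 + B₃ + π_A·π_B·π_C` with `π_E = μ(E) − ν(E)`. [this work] -/
theorem three_mul_polar₁_swap_eq_keyB0 (μ ν : Measure (BondConfig (Fin n))) (A B C : Set (BondConfig (Fin n))) :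
    3 * polar₁ ν μ A B C = keyB0 μ ν A B C + sahiE3 ν A B C
      + (μ.real A - ν.real A) * (μ.real B - ν.real B) * (μ.real C - ν.real C) := by
  rw [three_mul_polar₁_swap, keyB0]
  ring

/-- `B₁ ≥ 0` from `B₀ ≥ 0` and `keyB0 ≥ 0`. [this work] -/
theorem polar₁_nonneg_of_keyB0 {μ ν : Measure (BondConfig (Fin n))} {A B C : Set (BondConfig (Fin n))}
    (h0 : 0 ≤ sahiE3 μ A B C) (hK : 0 ≤ keyB0 μ ν A B C) : 0 ≤ polar₁ μ ν A B C := by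
  have h := three_mul_polar₁_eq_keyB0 μ ν A B C
  linarith

/-- `B₂ ≥ 0` from `B₃ ≥ 0`, `keyB0 ≥ 0` and `π_A·π_B·π_C ≥ 0` (no hypothesis on `B₀` needed). [this work] -/
theorem polar₁_swap_nonneg_of_keyB0 {μ ν : Measure (BondConfig (Fin n))} {A B C : Set (BondConfig (Fin n))}
    (h1 : 0 ≤ sahiE3 ν A B C) (hK : 0 ≤ keyB0 μ ν A B C)
    (hπ : 0 ≤ (μ.real A - ν.real A) * (μ.real B - ν.real B) * (μ.real C - ν.real C)) :
    0 ≤ polar₁ ν μ A B C := by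
  have h := three_mul_polar₁_swap_eq_keyB0 μ ν A B C
  linarith

/-- `K ≥ 0` and `B₀ ≥ 0` give `keyB0 ≥ 0` (the relaxed form is weaker than KEY). [this work] -/
theorem keyB0_nonneg_of_key {μ ν : Measure (BondConfig (Fin n))} {A B C : Set (BondConfig (Fin n))}
    (h0 : 0 ≤ sahiE3 μ A B C) (hK : 0 ≤ key μ ν A B C) : 0 ≤ keyB0 μ ν A B C := by
  unfold keyB0
  linarith

/-- **`keyB0` hypotheses at the terminal `i₀` with ALL-MARKINGS induction hypotheses**: for every `w`, injective `x`, unmarked `u`, `e = s(x i₀, u)`: IF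
`0 ≤ E₃(E₁ x', E₂ x', E₃ x')` under `w[e↦0]` and under `w[e↦1]` for EVERY injective `x'`, THEN `0 ≤ keyB0 μ_{w[e↦0]} μ_{w[e↦1]} (E₁ x) (E₂ x) (E₃ x)`. [this work] -/
def KeyB0HypAtAll (i₀ : Fin k) (E₁ E₂ E₃ : (Fin k → Fin n) → Set (BondConfig (Fin n))) : Prop :=
  ∀ (w : Sym2 (Fin n) → unitInterval) (x : Fin k → Fin n), Function.Injective x → ∀ (u : Fin n), (∀ j, x j ≠ u) →
    (∀ x' : Fin k → Fin n, Function.Injective x' →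
        0 ≤ sahiE3 (prodBernoulli (Function.update w s(x i₀, u) 0)) (E₁ x') (E₂ x') (E₃ x') ∧
        0 ≤ sahiE3 (prodBernoulli (Function.update w s(x i₀, u) 1)) (E₁ x') (E₂ x') (E₃ x')) →
    0 ≤ keyB0 (prodBernoulli (Function.update w s(x i₀, u) 0)) (prodBernoulli (Function.update w s(x i₀, u) 1)) (E₁ x) (E₂ x) (E₃ x)

variable {E₁ E₂ E₃ : (Fin k → Fin n) → Set (BondConfig (Fin n))}

/-- `KeyHypAtAll i₀` implies `KeyB0HypAtAll i₀` (the induction hypothesis at `x' = x` supplies `B₀ ≥ 0`). [this work] -/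
theorem KeyHypAtAll.toKeyB0 {i₀ : Fin k} (h : KeyHypAtAll i₀ E₁ E₂ E₃) : KeyB0HypAtAll i₀ E₁ E₂ E₃ :=
  fun w x hx u hu IH => keyB0_nonneg_of_key (IH x hx).1 (h w x hx u hu IH)

/-- **`keyB0 ≥ 0` (all-markings IH) ⇒ the unmarked-edge hypotheses (all-markings IH)**, for decreasing families. [this work] -/
theorem unmarkedEdgeHypAtAll_of_keyB0HypAtAll {i₀ : Fin k} (hE₁ : ∀ x, IsLowerSet (E₁ x)) (hE₂ : ∀ x, IsLowerSet (E₂ x))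
    (hE₃ : ∀ x, IsLowerSet (E₃ x)) (h : KeyB0HypAtAll i₀ E₁ E₂ E₃) : UnmarkedEdgeHypAtAll i₀ E₁ E₂ E₃ := by
  intro w x hx u hu IH
  have hK := h w x hx u hu IH
  exact ⟨polar₁_nonneg_of_keyB0 (IH x hx).1 hK,
    polar₁_swap_nonneg_of_keyB0 (IH x hx).2 hK (pivotal_prod_nonneg w s(x i₀, u) (hE₁ x) (hE₂ x) (hE₃ x))⟩

/-- **Group separations pinned at one terminal, from `keyB0 ≥ 0` with all-markings induction hypotheses.** [this work] -/
theorem sahiE3_sep_nonneg_of_keyB0HypAtAll (i₀ : Fin k) (I₁ J₁ I₂ J₂ I₃ J₃ : List (Fin k))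
    (hpin : I₁ = [i₀] ∨ J₁ = [i₀] ∨ I₂ = [i₀] ∨ J₂ = [i₀] ∨ I₃ = [i₀] ∨ J₃ = [i₀])
    (h : ∀ m : ℕ, KeyB0HypAtAll i₀ (fun x : Fin k → Fin m => connEvent (sep (I₁.map x) (J₁.map x)))
      (fun x => connEvent (sep (I₂.map x) (J₂.map x))) (fun x => connEvent (sep (I₃.map x) (J₃.map x))))
    (w : Sym2 (Fin n) → unitInterval) (x : Fin k → Fin n) (hx : Function.Injective x) :
    0 ≤ sahiE3 (prodBernoulli w) (connEvent (sep (I₁.map x) (J₁.map x))) (connEvent (sep (I₂.map x) (J₂.map x)))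
      (connEvent (sep (I₃.map x) (J₃.map x))) :=
  sahiE3_sep_nonneg_of_unmarkedEdgeHypAtAll i₀ I₁ J₁ I₂ J₂ I₃ J₃ hpin
    (fun m => unmarkedEdgeHypAtAll_of_keyB0HypAtAll (fun _ => isLowerSet_connEvent_sep _ _) (fun _ => isLowerSet_connEvent_sep _ _)
      (fun _ => isLowerSet_connEvent_sep _ _) (h m)) w x hx

/-- **PATH (row 36) on every finite weighted graph from `keyB0 = 3B₁ − B₀ ≥ 0` at ANY ONE terminal, certified with the all-markings induction hypotheses.** [this work] -/
theorem frontier_36_all_of_keyB0AtAll (i₀ : Fin 4)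
    (h : ∀ m : ℕ, KeyB0HypAtAll i₀ (fun x : Fin 4 → Fin m => connEvent (FrontierDecRows.row 36 m (x 0, x 1, x 2, x 3)).1)
      (fun x => connEvent (FrontierDecRows.row 36 m (x 0, x 1, x 2, x 3)).2.1)
      (fun x => connEvent (FrontierDecRows.row 36 m (x 0, x 1, x 2, x 3)).2.2))
    (w : Sym2 (Fin n) → unitInterval) (a b c y : Fin n) :
    0 ≤ sahiE3 (prodBernoulli w) (connEvent (FrontierDecRows.row 36 n (a, b, c, y)).1)
      (connEvent (FrontierDecRows.row 36 n (a, b, c, y)).2.1) (connEvent (FrontierDecRows.row 36 n (a, b, c, y)).2.2) :=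
  frontier_36_all_of_atAll i₀ (fun m => unmarkedEdgeHypAtAll_of_keyB0HypAtAll (fun x => (isLowerSet_row 36 x).1)
    (fun x => (isLowerSet_row 36 x).2.1) (fun x => (isLowerSet_row 36 x).2.2) (h m)) w a b c y

/-! ### The other pincer-free classes (FINDING-gen6 §1: keyB0 is roomy for 30-b, 12-b, 37-b, 15-y) -/

/-- **Row 30 `(D[ab|c], D[ac|by], D[b|cy])` at pairwise distinct terminals, for all `n`, from `keyB0 ≥ 0` at `b` or `c`** (all-markings IH). [this work] -/
theorem frontier_30_of_keyB0AtAll (i₀ : Fin 4) (hi₀ : i₀ = 1 ∨ i₀ = 2)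
    (h : ∀ m : ℕ, KeyB0HypAtAll i₀ (fun x : Fin 4 → Fin m => connEvent (FrontierDecRows.row 30 m (x 0, x 1, x 2, x 3)).1)
      (fun x => connEvent (FrontierDecRows.row 30 m (x 0, x 1, x 2, x 3)).2.1)
      (fun x => connEvent (FrontierDecRows.row 30 m (x 0, x 1, x 2, x 3)).2.2))
    (w : Sym2 (Fin n) → unitInterval) (a b c y : Fin n) (hab : a ≠ b) (hac : a ≠ c) (hay : a ≠ y) (hbc : b ≠ c)
    (hby : b ≠ y) (hcy : c ≠ y) :
    0 ≤ sahiE3 (prodBernoulli w) (connEvent (FrontierDecRows.row 30 n (a, b, c, y)).1)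
      (connEvent (FrontierDecRows.row 30 n (a, b, c, y)).2.1) (connEvent (FrontierDecRows.row 30 n (a, b, c, y)).2.2) := by
  have hx := injective_vec4 hab hac hay hbc hby hcy
  have hpin : [0, 1] = [i₀] ∨ [2] = [i₀] ∨ [0, 2] = [i₀] ∨ [1, 3] = [i₀] ∨ [1] = [i₀] ∨ [2, 3] = [i₀] := by
    rcases hi₀ with rfl | rfl <;> decide
  exact sahiE3_sep_nonneg_of_keyB0HypAtAll i₀ [0, 1] [2] [0, 2] [1, 3] [1] [2, 3] hpin h w ![a, b, c, y] hx

/-- **Row 12 `(D[ab|c], D[ac|by], D[b|y])` at pairwise distinct terminals, for all `n`, from `keyB0 ≥ 0` at ONE of `b`, `c`, `y`.** [this work] -/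
theorem frontier_12_of_keyB0AtAll (i₀ : Fin 4) (hi₀ : i₀ = 1 ∨ i₀ = 2 ∨ i₀ = 3)
    (h : ∀ m : ℕ, KeyB0HypAtAll i₀ (fun x : Fin 4 → Fin m => connEvent (FrontierDecRows.row 12 m (x 0, x 1, x 2, x 3)).1)
      (fun x => connEvent (FrontierDecRows.row 12 m (x 0, x 1, x 2, x 3)).2.1)
      (fun x => connEvent (FrontierDecRows.row 12 m (x 0, x 1, x 2, x 3)).2.2))
    (w : Sym2 (Fin n) → unitInterval) (a b c y : Fin n) (hab : a ≠ b) (hac : a ≠ c) (hay : a ≠ y) (hbc : b ≠ c)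
    (hby : b ≠ y) (hcy : c ≠ y) :
    0 ≤ sahiE3 (prodBernoulli w) (connEvent (FrontierDecRows.row 12 n (a, b, c, y)).1)
      (connEvent (FrontierDecRows.row 12 n (a, b, c, y)).2.1) (connEvent (FrontierDecRows.row 12 n (a, b, c, y)).2.2) := by
  have hx := injective_vec4 hab hac hay hbc hby hcy
  have hpin : [0, 1] = [i₀] ∨ [2] = [i₀] ∨ [0, 2] = [i₀] ∨ [1, 3] = [i₀] ∨ [1] = [i₀] ∨ [3] = [i₀] := by
    rcases hi₀ with rfl | rfl | rfl <;> decide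
  exact sahiE3_sep_nonneg_of_keyB0HypAtAll i₀ [0, 1] [2] [0, 2] [1, 3] [1] [3] hpin h w ![a, b, c, y] hx

/-- **Row 15 `(D[ab|c], D[ac|y], D[b|y])` at pairwise distinct terminals, for all `n`, from `keyB0 ≥ 0` at ONE of `b`, `c`, `y`.** [this work] -/
theorem frontier_15_of_keyB0AtAll (i₀ : Fin 4) (hi₀ : i₀ = 1 ∨ i₀ = 2 ∨ i₀ = 3)
    (h : ∀ m : ℕ, KeyB0HypAtAll i₀ (fun x : Fin 4 → Fin m => connEvent (FrontierDecRows.row 15 m (x 0, x 1, x 2, x 3)).1)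
      (fun x => connEvent (FrontierDecRows.row 15 m (x 0, x 1, x 2, x 3)).2.1)
      (fun x => connEvent (FrontierDecRows.row 15 m (x 0, x 1, x 2, x 3)).2.2))
    (w : Sym2 (Fin n) → unitInterval) (a b c y : Fin n) (hab : a ≠ b) (hac : a ≠ c) (hay : a ≠ y) (hbc : b ≠ c)
    (hby : b ≠ y) (hcy : c ≠ y) :
    0 ≤ sahiE3 (prodBernoulli w) (connEvent (FrontierDecRows.row 15 n (a, b, c, y)).1)
      (connEvent (FrontierDecRows.row 15 n (a, b, c, y)).2.1) (connEvent (FrontierDecRows.row 15 n (a, b, c, y)).2.2) := by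
  have hx := injective_vec4 hab hac hay hbc hby hcy
  have hpin : [0, 1] = [i₀] ∨ [2] = [i₀] ∨ [0, 2] = [i₀] ∨ [3] = [i₀] ∨ [1] = [i₀] ∨ [3] = [i₀] := by
    rcases hi₀ with rfl | rfl | rfl <;> decide
  exact sahiE3_sep_nonneg_of_keyB0HypAtAll i₀ [0, 1] [2] [0, 2] [3] [1] [3] hpin h w ![a, b, c, y] hx

/-- **Row 37 `(D[ab|c], D[ac|y], D[ay|b])` at pairwise distinct terminals, for all `n`, from `keyB0 ≥ 0` at ONE of `b`, `c`, `y`.** [this work] -/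
theorem frontier_37_of_keyB0AtAll (i₀ : Fin 4) (hi₀ : i₀ = 1 ∨ i₀ = 2 ∨ i₀ = 3)
    (h : ∀ m : ℕ, KeyB0HypAtAll i₀ (fun x : Fin 4 → Fin m => connEvent (FrontierDecRows.row 37 m (x 0, x 1, x 2, x 3)).1)
      (fun x => connEvent (FrontierDecRows.row 37 m (x 0, x 1, x 2, x 3)).2.1)
      (fun x => connEvent (FrontierDecRows.row 37 m (x 0, x 1, x 2, x 3)).2.2))
    (w : Sym2 (Fin n) → unitInterval) (a b c y : Fin n) (hab : a ≠ b) (hac : a ≠ c) (hay : a ≠ y) (hbc : b ≠ c)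
    (hby : b ≠ y) (hcy : c ≠ y) :
    0 ≤ sahiE3 (prodBernoulli w) (connEvent (FrontierDecRows.row 37 n (a, b, c, y)).1)
      (connEvent (FrontierDecRows.row 37 n (a, b, c, y)).2.1) (connEvent (FrontierDecRows.row 37 n (a, b, c, y)).2.2) := by
  have hx := injective_vec4 hab hac hay hbc hby hcy
  have hpin : [0, 1] = [i₀] ∨ [2] = [i₀] ∨ [0, 2] = [i₀] ∨ [3] = [i₀] ∨ [0, 3] = [i₀] ∨ [1] = [i₀] := by
    rcases hi₀ with rfl | rfl | rfl <;> decide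
  exact sahiE3_sep_nonneg_of_keyB0HypAtAll i₀ [0, 1] [2] [0, 2] [3] [0, 3] [1] hpin h w ![a, b, c, y] hx

end TerminalEdgeInduction

end Summit.CriticalPhenomena.PercolationContinuityZ3.Theorems
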